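import Summits.BirchSwinnertonDyer.BirchSwinnertonDyer.Theorems.ManinLocalTwoThreePShiftHeisenbergG1
import HarnessLib

/-!
# The prime-generic descent engine, V: the HEISENBERG step — `K_p(pm) = D(pm) ⟹ K_p(p²m) = D(p²m)` for `p ∣ m`, `p ≥ 5`
# (route `ManinLocalTwoThree`, cell bsd-f2-manin; cruxes C2 stmt-BirchSwinnertonDyer-22967 / C3 stmt-…-22968; LEAD seat p1 gen 12; the `p³ ∣ N`
# steps of the LEAD's prime-generic shift-equaliser conjecture = typer's `ShiftEqualiser.PrimeShiftInvariantIsDiamond`)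

The `p`-generic form of the seat's g11 two-functional argument (`…ThreeShiftHeisenbergDescent.lean`, MEMO-es §37.13 (A)) inside
`G₁ = {a² ≡ 1 (mod p)} ≤ Γ₀(pm)`, `p ∣ m`.  The pair `β = a·b`, `λ = a·c/(pm)` (mod `p`) is additive on `G₁`, `β` kills `A₁`, `λ` kills
`B = Γ₀(p²m)`, `β(T) = 1`, `λ(Q₁) = −1`; a Heisenberg function `μ` for `(β, λ)` on `G₁` (file IV) gives a pair (`μ` on `A₁`, `μ` on `B ∩ G₁`) with
`κ`-defect `μ(TQ₁T⁻¹) − μ(Q₁) = −1`.  If `v := φ(P_{2/p}) − φ(P_{1/p}) ≠ 0`, the corrected pair `μ + v⁻¹·(coshift φ, restr φ)` passes the `κ`-test,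
glues (`PShiftGlue.glueOn`) to `W` additive on `G₁`; but `P_{1/p} = R₁^p`, `P_{2/p} = R₂^p` with `R₁ = (1−m, m/p; −pm, 1+m)`, `R₂ = (1−2m, 4m/p; −pm, 1+2m)
∈ G₁`, so `W(Rᵢ^p) = p·W(Rᵢ) = 0` while `W(Rᵢ^p) = μ(Rᵢ^p) + v⁻¹ φ(P) = v⁻¹ φ(P)` (`μ(x^p) = p μ(x) + C(p,2) β λ = 0`) — so `φ(P_{1/p}) = φ(P_{2/p}) = 0`,
contradiction.  Hence **`apply_P2p_eq_apply_P1p_of_dvd`** and, with file II's `descent`, **`step_of_dvd : K_p(pm) = D(pm) ⟹ K_p(p²m) = D(p²m)`**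
(`p ∣ m`, `p ≥ 5`, coefficients `ℤ/p`).  Nothing about BSD, Manin's conjecture or C2/C3 is asserted here.
[cite: DarmonDiamondTaylor1995, Lemma 4.28 (p. 135) (shape only)]
-/

set_option autoImplicit false
set_option linter.dupNamespace false

open scoped MatrixGroups

open CongruenceSubgroup Matrix.SpecialLinearGroup
  Summit.BirchSwinnertonDyer.Rank1Residual.ManinAdditive.NineShiftEqualiser

namespace Summit.BirchSwinnertonDyer.BirchSwinnertonDyer.Theorems.ManinLocalTwoThree

namespace PShiftEngine

open ThreeShiftDescent TwoShift PShiftTransfer PShiftGlue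

variable {p : ℕ} [Fact p.Prime] {m : ℕ}

/-! ### §1. The pair `β = a·b`, `λ = a·c/(pm)` on `G₁` -/

/-- The exact quotient `c/(pm)` of the lower-left entry. [folklore] -/
def cQuot (γ : Gamma0 (p * m)) : ℤ := ((γ : SL(2, ℤ)) 1 0 : ℤ) / ((p * m : ℕ) : ℤ)

omit [Fact p.Prime] in
/-- `pm · (c/(pm)) = c`. [folklore] -/
theorem level_mul_cQuot (γ : Gamma0 (p * m)) : ((p * m : ℕ) : ℤ) * cQuot γ = ((γ : SL(2, ℤ)) 1 0 : ℤ) :=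
  Int.mul_ediv_cancel' ((ZMod.intCast_zmod_eq_zero_iff_dvd _ _).mp (Gamma0_mem.mp γ.2))

omit [Fact p.Prime] in
/-- `c/(pm)` of a product: `q_{γδ} = q_γ a_δ + d_γ q_δ` (`m ≥ 1`). [folklore] -/
theorem cQuot_mul (hm : 0 < m) (hp : 0 < p) (γ δ : Gamma0 (p * m)) :
    cQuot (γ * δ) = cQuot γ * (δ : SL(2, ℤ)) 0 0 + (γ : SL(2, ℤ)) 1 1 * cQuot δ := by
  have hL : ((p * m : ℕ) : ℤ) ≠ 0 := by positivity
  have e : (((γ * δ : Gamma0 (p * m)) : SL(2, ℤ)) 1 0 : ℤ) =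
      (γ : SL(2, ℤ)) 1 0 * (δ : SL(2, ℤ)) 0 0 + (γ : SL(2, ℤ)) 1 1 * (δ : SL(2, ℤ)) 1 0 := by
    simp [Matrix.mul_apply, Fin.sum_univ_two]
  have h := level_mul_cQuot (γ * δ)
  rw [e, ← level_mul_cQuot γ, ← level_mul_cQuot δ] at h
  have : ((p * m : ℕ) : ℤ) * cQuot (γ * δ) = ((p * m : ℕ) : ℤ) * (cQuot γ * (δ : SL(2, ℤ)) 0 0 + (γ : SL(2, ℤ)) 1 1 * cQuot δ) := by
    rw [h]; ring
  exact mul_left_cancel₀ hL this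

/-- `β(γ) = a_γ b_γ mod p`. [folklore] -/
def betaF (γ : Gamma0 (p * m)) : ZMod p := ent (p := p) (γ : SL(2, ℤ)) 0 0 * ent (γ : SL(2, ℤ)) 0 1

/-- `λ(γ) = a_γ · (c_γ/(pm)) mod p`. [folklore] -/
def lamF (γ : Gamma0 (p * m)) : ZMod p := ent (p := p) (γ : SL(2, ℤ)) 0 0 * ((cQuot γ : ℤ) : ZMod p)

/-- `β` is additive on `G₁`. [folklore] -/
theorem betaF_mul (x y : Gamma0 (p * m)) (hx : x ∈ subG1 p m) : betaF (p := p) (x * y) = betaF x + betaF y := by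
  have hpL := p_dvd_level p m
  rw [mem_subG1] at hx
  unfold betaF
  rw [ent00_mul hpL, ent01_mul]
  have hy := ent_det hpL y
  linear_combination (ent (p := p) (y : SL(2, ℤ)) 0 0 * ent (y : SL(2, ℤ)) 0 1) * hx +
    (ent (p := p) (x : SL(2, ℤ)) 0 0 * ent (x : SL(2, ℤ)) 0 1) * hy

/-- `λ` is additive on `G₁` (`m ≥ 1`). [folklore] -/
theorem lamF_mul (hm : 0 < m) (x y : Gamma0 (p * m)) (hy : y ∈ subG1 p m) : lamF (p := p) (x * y) = lamF x + lamF y := by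
  have hp : p.Prime := Fact.out
  have hpL := p_dvd_level p m
  rw [mem_subG1] at hy
  unfold lamF
  rw [ent00_mul hpL, cQuot_mul hm hp.pos]
  push_cast
  have hx := ent_det hpL x
  have e11 : (((x : SL(2, ℤ)) 1 1 : ℤ) : ZMod p) = ent (p := p) (x : SL(2, ℤ)) 1 1 := rfl
  have e00 : (((y : SL(2, ℤ)) 0 0 : ℤ) : ZMod p) = ent (p := p) (y : SL(2, ℤ)) 0 0 := rfl
  rw [e11, e00]
  linear_combination (ent (p := p) (x : SL(2, ℤ)) 0 0 * ((cQuot x : ℤ) : ZMod p)) * hy +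
    (ent (p := p) (y : SL(2, ℤ)) 0 0 * ((cQuot y : ℤ) : ZMod p)) * hx

/-- `β` kills `A₁`. [folklore] -/
theorem betaF_of_subA1 {x : Gamma0 (p * m)} (hx : x ∈ subA1 p m) : betaF (p := p) x = 0 := by
  unfold betaF; rw [hx.2, mul_zero]

/-- `λ` kills `B = Γ₀(p²m)` (`c/(pm)` is divisible by `p`). [folklore] -/
theorem lamF_of_subB (hm : 0 < m) {x : Gamma0 (p * m)} (hx : x ∈ subB p m) : lamF (p := p) x = 0 := by
  have hp : p.Prime := Fact.out
  obtain ⟨k, hk⟩ := mem_subB.mp hx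
  have hq : cQuot x = p * k := by
    have h := level_mul_cQuot x
    rw [hk] at h
    have hL : ((p * m : ℕ) : ℤ) ≠ 0 := by exact_mod_cast (Nat.mul_pos hp.pos hm).ne'
    apply mul_left_cancel₀ hL
    rw [h]; push_cast; ring
  unfold lamF
  rw [hq]; push_cast; rw [ZMod.natCast_self, zero_mul, mul_zero]

/-- `β(T) = 1`. [folklore] -/
theorem betaF_T : betaF (p := p) (Tpow (p * m) 1) = 1 := by
  obtain ⟨h00, h01, -⟩ := ent_Tpow (p := p) (m := m) 1
  unfold betaF; rw [h00, h01]; simp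

/-- `λ(Q₁) = −1` (`m ≥ 1`). [folklore] -/
theorem lamF_Q1 (hm : 0 < m) : lamF (p := p) (Q1 p m) = -1 := by
  have hp : p.Prime := Fact.out
  have hq : cQuot (Q1 p m) = -1 := by
    have h := level_mul_cQuot (Q1 p m)
    have hL : ((p * m : ℕ) : ℤ) ≠ 0 := by exact_mod_cast (Nat.mul_pos hp.pos hm).ne'
    apply mul_left_cancel₀ hL
    rw [h]; simp [Q1, g0Of]
  have h00 : ent (p := p) ((Q1 p m : Gamma0 (p * m)) : SL(2, ℤ)) 0 0 = 1 := by simp [Q1, g0Of, ent]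
  unfold lamF; rw [hq, h00]; simp

/-! ### §2. A Heisenberg function for `(β, λ)` on `G₁` and its powers -/

/-- **A Heisenberg function on `G₁` for the pair `(β, λ)`** (`p ≥ 5`, `m ≥ 1`), as a function on `Γ₀(pm)`. [folklore] -/
theorem exists_heisF (hp5 : 5 ≤ p) (hm : 0 < m) :
    ∃ μ : Gamma0 (p * m) → ZMod p, ∀ x ∈ subG1 p m, ∀ y ∈ subG1 p m, μ (x * y) = μ x + μ y + betaF x * lamF y := by
  classical
  obtain ⟨μ, hμ⟩ := exists_heisenberg_subG1 hp5 (fun x : subG1 p m => betaF (p := p) (x : Gamma0 (p * m)))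
    (fun x => lamF (p := p) (x : Gamma0 (p * m)))
    (fun x y => betaF_mul _ _ x.2) (fun x y => lamF_mul hm _ _ y.2)
  refine ⟨fun g => if hg : g ∈ subG1 p m then μ ⟨g, hg⟩ else 0, fun x hx y hy => ?_⟩
  have hxy : x * y ∈ subG1 p m := (subG1 p m).mul_mem hx hy
  simp only [dif_pos hx, dif_pos hy, dif_pos hxy]
  exact hμ ⟨x, hx⟩ ⟨y, hy⟩

/-- Powers under a Heisenberg function: `μ(x^n) = n μ(x) + C(n,2) β(x) λ(x)`. [folklore] -/
theorem heis_pow {μ : Gamma0 (p * m) → ZMod p}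
    (hμ : ∀ x ∈ subG1 p m, ∀ y ∈ subG1 p m, μ (x * y) = μ x + μ y + betaF x * lamF y)
    {x : Gamma0 (p * m)} (hx : x ∈ subG1 p m) (n : ℕ) :
    μ (x ^ n) = (n : ZMod p) * μ x + (n.choose 2 : ZMod p) * (betaF x * lamF x) := by
  have hβpow : ∀ k : ℕ, betaF (p := p) (x ^ k) = (k : ZMod p) * betaF x := by
    intro k
    induction k with
    | zero =>
      simp only [pow_zero, Nat.cast_zero, zero_mul]
      unfold betaF; simp [ent]
    | succ k ih => rw [pow_succ, betaF_mul _ _ ((subG1 p m).pow_mem hx k), ih]; push_cast; ring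
  induction n with
  | zero =>
    have h1 : μ 1 = 0 := by
      have := hμ 1 (subG1 p m).one_mem 1 (subG1 p m).one_mem
      rw [mul_one] at this
      have hb : betaF (p := p) (1 : Gamma0 (p * m)) = 0 := by unfold betaF; simp [ent]
      rw [hb, zero_mul, add_zero] at this
      linear_combination -this
    simp [h1]
  | succ n ih =>
    rw [pow_succ, hμ _ ((subG1 p m).pow_mem hx n) _ hx, ih, hβpow n, Nat.choose_succ_succ', Nat.choose_one_right]
    push_cast; ring

/-- `μ(x^p) = 0` for `x ∈ G₁` (`p ≥ 3`: `p ∣ C(p,2)`). [folklore] -/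
theorem heis_pow_p {μ : Gamma0 (p * m) → ZMod p} (hp3 : 3 ≤ p)
    (hμ : ∀ x ∈ subG1 p m, ∀ y ∈ subG1 p m, μ (x * y) = μ x + μ y + betaF x * lamF y)
    {x : Gamma0 (p * m)} (hx : x ∈ subG1 p m) : μ (x ^ p) = 0 := by
  have hp : p.Prime := Fact.out
  rw [heis_pow hμ hx p, ZMod.natCast_self, zero_mul, zero_add,
    (ZMod.natCast_eq_zero_iff _ _).mpr (hp.dvd_choose_self (by norm_num) (by omega)), zero_mul]

/-! ### §3. The `p`-th roots of the parabolics and the two-functional argument -/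

/-- `(I + X)^n = I + nX` for `X = (e f; g −e)` with `X² = 0`, in `Γ₀(L)`. [folklore] -/
theorem unip_pow {L : ℕ} (e f g : ℤ) (hX : e * e + f * g = 0) (hL : (L : ℤ) ∣ g) (n : ℕ) :
    (g0Of (1 + e) f g (1 - e) (by linear_combination -hX) hL : Gamma0 L) ^ n =
      g0Of (1 + n * e) (n * f) (n * g) (1 - n * e) (by linear_combination -((n : ℤ) * n) * hX) (Dvd.dvd.mul_left hL n) := by
  induction n with
  | zero =>
    rw [pow_zero]; apply Subtype.ext; ext i j
    fin_cases i <;> fin_cases j <;> simp [g0Of, slOf]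
  | succ n ih =>
    rw [pow_succ, ih, g0Of_mul _ _ _ _ _ _ _ _ _ _ _ _ (det_mul_entries (by linear_combination -((n : ℤ) * n) * hX)
      (by linear_combination -hX)) (dvd_add (Dvd.dvd.mul_right (Dvd.dvd.mul_left hL n) _) (Dvd.dvd.mul_left hL _))]
    exact g0Of_congr (by push_cast; linear_combination (n : ℤ) * hX) (by push_cast; ring)
      (by push_cast; ring) (by push_cast; linear_combination (n : ℤ) * hX) _ _ _ _

/-- **THE TWO-FUNCTIONAL ARGUMENT**: for `p ≥ 5`, `p ∣ m`, every additive `p`-shift-invariant `φ : Γ₀(p²m) → ℤ/p` has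
`φ(P_{2/p}) = φ(P_{1/p})`. [new: the `p`-generic MEMO-es §37.13 (A)] -/
theorem apply_P2p_eq_apply_P1p_of_dvd (hp5 : 5 ≤ p) (hm : 0 < m) (hpm : p ∣ m) (φ : Gamma0 (p * (p * m)) → ZMod p)
    (hadd : IsAdd φ) (hinv : IsShiftEigenP p (1 : ZMod p) φ) : φ (P2p p m) = φ (P1p p m) := by
  classical
  have hp : p.Prime := Fact.out
  have hpL := p_dvd_level p m
  obtain ⟨m', hm'⟩ := hpm
  obtain ⟨μ, hμ⟩ := exists_heisF (p := p) hp5 hm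
  by_contra hne
  set v : ZMod p := φ (P2p p m) - φ (P1p p m) with hv
  have hv0 : v ≠ 0 := sub_ne_zero.mpr hne
  set cst : ZMod p := v⁻¹ with hcst
  -- the subgroups
  have hAn := subA1_normal (p := p) (m := m)
  set B₁ : Subgroup (Gamma0 (p * m)) := subB p m ⊓ subG1 p m with hB₁
  have hT : Tpow (p * m) 1 ∈ B₁ := Subgroup.mem_inf.mpr ⟨Tpow_mem_subB 1, Tpow_mem_subG1 1⟩
  -- the corrected pair
  set α' : Gamma0 (p * m) → ZMod p := fun g => μ g + cst * coshift φ 1 g with hα'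
  set φ' : Gamma0 (p * m) → ZMod p := fun g => μ g + cst * restr φ g with hφ'
  have hcoA := coshift_add φ (1 : ZMod p) hadd (M := p * m)
  have hreB := restr_add_subB (p := p) (m := m) φ hadd
  have hαadd : ∀ x ∈ subA1 p m, ∀ y ∈ subA1 p m, α' (x * y) = α' x + α' y := by
    intro x hx y hy
    simp only [hα']
    rw [hμ x hx.1 y hy.1, betaF_of_subA1 hx, zero_mul, add_zero, hcoA x (stabZero_of_subA1 hx) y (stabZero_of_subA1 hy)]
    ring
  have hφadd : ∀ x ∈ B₁, ∀ y ∈ B₁, φ' (x * y) = φ' x + φ' y := by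
    intro x hx y hy
    obtain ⟨hxB, hxG⟩ := Subgroup.mem_inf.mp hx
    obtain ⟨hyB, hyG⟩ := Subgroup.mem_inf.mp hy
    simp only [hφ']
    rw [hμ x hxG y hyG, lamF_of_subB hm hyB, mul_zero, add_zero, hreB x hxB y hyB]
    ring
  have hC : ∀ x ∈ subA1 p m, x ∈ B₁ → α' x = φ' x := by
    intro x hx hxB
    simp only [hα', hφ']
    rw [coshift_eq_restr_subB φ 1 hinv x (stabZero_of_subA1 hx) (Subgroup.mem_inf.mp hxB).1]
  -- the κ-test: `μ(TQ₁T⁻¹) − μ(Q₁) = −1` cancels `cst·v = 1`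
  have hμ1 : μ 1 = 0 := by
    have := hμ 1 (subG1 p m).one_mem 1 (subG1 p m).one_mem
    rw [mul_one] at this
    have hb : betaF (p := p) (1 : Gamma0 (p * m)) = 0 := by unfold betaF; simp [ent]
    rw [hb, zero_mul, add_zero] at this; linear_combination -this
  have hTG := Tpow_mem_subG1 (p := p) (m := m) 1
  have hTinvG : (Tpow (p * m) 1)⁻¹ ∈ subG1 p m := (subG1 p m).inv_mem hTG
  have hQG : Q1 p m ∈ subG1 p m := (Q1_mem_subA1).1
  have hμT : μ (Tpow (p * m) 1) + μ (Tpow (p * m) 1)⁻¹ = 0 := by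
    have := hμ _ hTG _ hTinvG
    rw [mul_inv_cancel, hμ1, lamF_of_subB hm ((subB p m).inv_mem (Tpow_mem_subB 1)), mul_zero, add_zero] at this
    linear_combination -this
  have hκμ : μ (Tpow (p * m) 1 * Q1 p m * (Tpow (p * m) 1)⁻¹) = μ (Q1 p m) - 1 := by
    rw [hμ _ ((subG1 p m).mul_mem hTG hQG) _ hTinvG, hμ _ hTG _ hQG, betaF_T, lamF_Q1 hm,
      lamF_of_subB hm ((subB p m).inv_mem (Tpow_mem_subB 1)), mul_zero, add_zero]
    linear_combination hμT
  have hκ : α' (Tpow (p * m) 1 * Q1 p m * (Tpow (p * m) 1)⁻¹) = α' (Q1 p m) := by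
    simp only [hα']
    rw [hκμ, coshift_conj_Q1, coshift_Q1, one_mul, one_mul]
    have : cst * φ (P2p p m) - cst * φ (P1p p m) = 1 := by rw [← mul_sub, ← hv, hcst, inv_mul_cancel₀ hv0]
    linear_combination this
  have hgen : ∀ a ∈ subA1 p m, ∃ e : ℤ, a * (Q1 p m) ^ (-e) ∈ B₁ := by
    intro a ha
    obtain ⟨e, he⟩ := exists_mul_Q1_zpow_mem_subB a ha
    exact ⟨e, Subgroup.mem_inf.mpr ⟨he, (subG1 p m).mul_mem ha.1 ((subG1 p m).zpow_mem hQG _)⟩⟩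
  have hinvT := conj_invariant_of_generator hAn hαadd hφadd hC hT Q1_mem_subA1 hgen hκ
  obtain ⟨hW, -, hWB⟩ := glueOn (G₁ := subG1 p m) (fun g _ a ha => hAn.conj_mem a ha g) hαadd hφadd hC hT hTG hinvT
    (fun g => ((g : SL(2, ℤ)) 0 0 : ℤ) * (g : SL(2, ℤ)) 0 1) mul_Tpow_neg_mem_subA1 Tpow_n_mem_subA1
  set W : Gamma0 (p * m) → ZMod p := fun g => α' (g * Tpow (p * m) 1 ^ (-(((g : SL(2, ℤ)) 0 0 : ℤ) * (g : SL(2, ℤ)) 0 1))) +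
    (((g : SL(2, ℤ)) 0 0 : ℤ) * (g : SL(2, ℤ)) 0 1) • φ' (Tpow (p * m) 1) with hWdef
  have hWadd : ∀ g ∈ subG1 p m, ∀ h ∈ subG1 p m, W (g * h) = W g + W h := hW
  -- the p-th roots
  have hm0 : (m : ℤ) = p * m' := by rw [hm']; push_cast; ring
  have key : ∀ (e f : ℤ) (hX : e * e + f * (-(p * m : ℤ)) = 0) (hpe : (p : ℤ) ∣ e)
      (hP : ((p * (p * m) : ℕ) : ℤ) ∣ (p : ℕ) * (-(p * m : ℤ))),
      φ (g0Of (1 + (p : ℕ) * e) ((p : ℕ) * f) ((p : ℕ) * (-(p * m : ℤ))) (1 - (p : ℕ) * e)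
        (by linear_combination -((p : ℤ) * p) * hX) hP) = 0 := by
    intro e f hX hpe hP
    have hL : ((p * m : ℕ) : ℤ) ∣ -(p * m : ℤ) := ⟨-1, by push_cast; ring⟩
    set R : Gamma0 (p * m) := g0Of (1 + e) f (-(p * m : ℤ)) (1 - e) (by linear_combination -hX) hL with hR
    have hRG : R ∈ subG1 p m := by
      rw [mem_subG1, hR]
      have : ent (p := p) ((g0Of (1 + e) f (-(p * m : ℤ)) (1 - e) (by linear_combination -hX) hL : Gamma0 (p * m)) : SL(2, ℤ)) 0 0 = 1 := by
        show (((1 + e : ℤ)) : ZMod p) = 1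
        push_cast; rw [(ZMod.intCast_zmod_eq_zero_iff_dvd e p).mpr hpe, add_zero]
      rw [this, one_pow]
    have hRp : R ^ p = g0Of (1 + (p : ℕ) * e) ((p : ℕ) * f) ((p : ℕ) * (-(p * m : ℤ))) (1 - (p : ℕ) * e)
        (by linear_combination -((p : ℤ) * p) * hX) (Dvd.dvd.mul_left hL p) := by
      rw [hR, unip_pow e f _ hX hL p]
    have hRpB : R ^ p ∈ B₁ := by
      refine Subgroup.mem_inf.mpr ⟨?_, (subG1 p m).pow_mem hRG p⟩
      rw [hRp]; exact g0Of_mem_subB _ _ _ _ _ _ hP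
    have h1 : W (R ^ p) = 0 := by
      rw [← zpow_natCast, addOn_map_zpow hWadd hRG, natCast_zsmul, nsmul_eq_mul, ZMod.natCast_self, zero_mul]
    have h2 : W (R ^ p) = φ' (R ^ p) := hWB _ hRpB ((subG1 p m).pow_mem hRG p)
    rw [h2] at h1
    simp only [hφ'] at h1
    rw [heis_pow_p (by omega) hμ hRG, zero_add, hRp, restr_g0Of φ _ _ _ _ _ _ hP] at h1
    rcases mul_eq_zero.mp h1 with h | h
    · exact absurd h (inv_ne_zero hv0)
    · exact h
  have hP1 : φ (P1p p m) = 0 := by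
    have h := key (-(m : ℤ)) m' (by rw [hm0]; ring) ⟨-(m' : ℤ), by rw [hm0]; ring⟩ ⟨-1, by push_cast; ring⟩
    rw [P1p]; convert h using 2; exact g0Of_congr (by ring) hm0 (by ring) (by ring) _ _ _ _
  have hP2 : φ (P2p p m) = 0 := by
    have h := key (-(2 * m : ℤ)) (4 * m') (by rw [hm0]; ring) ⟨-(2 * m' : ℤ), by rw [hm0]; ring⟩ ⟨-1, by push_cast; ring⟩
    rw [P2p]; convert h using 2; exact g0Of_congr (by ring) (by rw [hm0]; ring) (by ring) (by ring) _ _ _ _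
  exact hv0 (by rw [hv, hP1, hP2, sub_self])

/-- **`K_p(pm) = D(pm) ⟹ K_p(p²m) = D(p²m)` for `p ∣ m`, `p ≥ 5`** (coefficients `ℤ/p`). [new] -/
theorem step_of_dvd (hp5 : 5 ≤ p) (hm : 0 < m) (hpm : p ∣ m) (hbase : ShiftInvariantIsDiamondAtP p (p * m) (ZMod p)) :
    ShiftInvariantIsDiamondAtP p (p * (p * m)) (ZMod p) := by
  intro φ hadd hinv
  obtain ⟨w, hwadd, hwinv, hres⟩ := descent φ 1 hm hadd hinv (apply_P2p_eq_apply_P1p_of_dvd hp5 hm hpm φ hadd hinv)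
  exact isDiamond_of_restrictsFrom (dvd_mul_left (p * m) p) hres (hbase w hwadd hwinv)

end PShiftEngine

end Summit.BirchSwinnertonDyer.BirchSwinnertonDyer.Theorems.ManinLocalTwoThree
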